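import Summits.HodgeConjecture.HodgeConjecture.Theorems.K2E1bDSClsOfRecord                      -- ★ p856729 (Q9c): `dsCellRep`, `dsCellRep_package`, `dsClsOfRecord`, `dsClsOfRecord_of_regular`, `dsCarriersOfRecord`
import Literature.NumberTheory.Automorphic.GKInfinitesimallyUnitaryConverse                        -- ★ `isInfUnitary_of_isInfUnitaryAlongP` (the six clauses ⇒ Borel–Wallach unitarity, `U(2,1)`)
import Literature.NumberTheory.Automorphic.HasUnitaryGlobalizationOfInfUnitaryU21                  -- ★ `hasUnitaryGlobalization_of_isInfUnitary_uTwoOne` (Knapp–Vogan Thm. 0.6 (a) ∕ Harish-Chandra, PROVED at `U(2,1)`)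
import HarnessLib

/-!
# K2 ∕ E1b unit U8, Deal Q9e `K2E1bDSRecordLawGlob`: the record table of the discrete-series packet has UNITARY GLOBALIZATIONS —
# `lawGlob_dsCarriersOfRecord : dsCarriersOfRecord.LawGlob` (pays the U8d socket U8-4e BY NAME)

HCML Track B «K2-LIT», cell `hodgecm-mathlib`, crux H413 = stmt-HodgeConjecture-24833 (supports-only helper; closes nothing by itself).  Deal Q9e of
K2E1b-plan (g3) 2026-09-04T02:39:24Z («GO» BY NAME, recipe 02:16Z); hand K2E4-p10 (g2).  THEOREMS ONLY; no `sorry`, no named `Prop` fact, no instance (one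
`attribute [local instance] LieRing.ofAssociativeRing`, the idiom of ★ `K2E1bDSClsOfRecord` ∕ ★ `K2E1bCarriersOfRecord`), no notation.

THE MATHEMATICS [KnappVogan1995 Introduction Thm. 0.6 (a); HarishChandra1953 Thms. 8–9; BorelWallach2000 0 §2.5, VI Thm. 4.12].  At a regular parameter the
class `dsClsOfRecord a b c j` is `GKIrrClass.mk (dsCellRep a b c j h)` (★ `dsClsOfRecord_of_regular`), and ★ `dsCellRep_package` says the representative is
coh-unitary irreducible: a `(𝔤,K)`-module (`.gk`), ADMISSIBLE (`.adm`), and unitary along `𝔭 ⊕ ℝz₀` (`.unit : IsUnitaryAlongP`, body-identical with ★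
`IsInfUnitaryAlongP`).  ★ `isInfUnitary_of_isInfUnitaryAlongP` upgrades the six clauses to Borel–Wallach infinitesimal unitarity (★ `Liu2021.LemD2.IsInfUnitary`),
and ★ `hasUnitaryGlobalization_of_isInfUnitary_uTwoOne` (Harish-Chandra's globalization theorem, PROVED in the tree at `U(2,1)`) gives a unitary Hilbert
globalization of the class.  So every member of the record table has a unitary globalization — law ★ `DSPacketCarriers.LawGlob`.

HONEST LABEL: HC_CM is proved only modulo the 7 printed citations (2 remaining named inputs: hLiu418 = stmt-HodgeConjecture-24832, h413 = stmt-HodgeConjecture-24833)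
until rung 0 closes; a law of the carrier table closes nothing by itself.
-/

set_option autoImplicit false
set_option linter.dupNamespace false

noncomputable section

open Literature.NumberTheory.Automorphic
open Literature.RepresentationTheory
open Literature.RepresentationTheory.KonnoKonno2007 Literature.RepresentationTheory.KonnoKonno2007.RealDualPair
open Summit.HodgeConjecture.HodgeConjecture.Cruxes.H413.K2E1bGKCohomologyU21.U8
open Summit.HodgeConjecture.HodgeConjecture.Cruxes.H413.K2E1bDSClsOfRecord

namespace Summit.HodgeConjecture.HodgeConjecture.Cruxes.H413.K2E1bDSRecordLawGlob

-- Mathlib idiom (as in ★ `K2E1bDSClsOfRecord`): `Module.End ℂ V` as a Lie ring by commutators.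
attribute [local instance 100] LieRing.ofAssociativeRing

/-- **The member of record is infinitesimally unitary in the Borel–Wallach sense** (★ `Liu2021.LemD2.IsInfUnitary`): the six clauses `IsUnitaryAlongP` of ★
`dsCellRep_package` upgraded by ★ `isInfUnitary_of_isInfUnitaryAlongP`. [cite: BorelWallach2000, 0 §2.5; VI Thm. 4.12] -/
theorem dsCellRep_isInfUnitary {a b c : ℤ} (h : IsRegularParam a b c) (j : Fin 3) :
    Liu2021.LemD2.IsInfUnitary (dsCellRep a b c j h).ρK (dsCellRep a b c j h).ρ𝔤 := by
  obtain ⟨hcoh, -⟩ := dsCellRep_package h j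
  exact isInfUnitary_of_isInfUnitaryAlongP hcoh.gk hcoh.unit

/-- **The class of the member of record has a unitary globalization** (Harish-Chandra ∕ Knapp–Vogan Thm. 0.6 (a) at `U(2,1)`, ★
`hasUnitaryGlobalization_of_isInfUnitary_uTwoOne`, fed with admissibility `.adm` and `dsCellRep_isInfUnitary`).
[cite: KnappVogan1995, Introduction Thm. 0.6 (a)] [cite: HarishChandra1953, Thms. 8–9] -/
theorem hasUnitaryGlobalization_dsCellRep {a b c : ℤ} (h : IsRegularParam a b c) (j : Fin 3) :
    HasUnitaryGlobalization (uFormGroup (Fin 2) (Fin 1)) (GKIrrClass.mk (dsCellRep a b c j h)) := by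
  obtain ⟨hcoh, -⟩ := dsCellRep_package h j
  exact hasUnitaryGlobalization_of_isInfUnitary_uTwoOne (dsCellRep a b c j h) hcoh.adm (dsCellRep_isInfUnitary h j)

/-- **`dsClsOfRecord a b c j` has a unitary globalization** at every regular parameter. [cite: KnappVogan1995, Introduction Thm. 0.6 (a)] [cite: Rogawski1990, §12.3 p. 178] -/
theorem hasUnitaryGlobalization_dsClsOfRecord {a b c : ℤ} (h : IsRegularParam a b c) (j : Fin 3) :
    HasUnitaryGlobalization (uFormGroup (Fin 2) (Fin 1)) (dsClsOfRecord a b c j) := by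
  rw [dsClsOfRecord_of_regular h j]
  exact hasUnitaryGlobalization_dsCellRep h j

/-- **LAW «unitary globalization» for the table of record**: `dsCarriersOfRecord.LawGlob` («Π is square-integrable»; each member is the Harish-Chandra module of a
unitary representation of `U(2,1)`). [cite: Rogawski1990, §12.3 p. 178] [cite: KnappVogan1995, Introduction Thm. 0.6 (a)] -/
theorem lawGlob_dsCarriersOfRecord : dsCarriersOfRecord.LawGlob :=
  fun _ _ _ h j => hasUnitaryGlobalization_dsClsOfRecord h j

end Summit.HodgeConjecture.HodgeConjecture.Cruxes.H413.K2E1bDSRecordLawGlob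

end
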